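import Literature.NumberTheory.EllipticCurves.HeegnerGeomLevelDividingRelationProofs
import Literature.NumberTheory.EllipticCurves.AnticyclotomicTowerSharpProofs
import Literature.NumberTheory.EllipticCurves.Castella2024.LambdaAdicHeegnerClassExistence
import Literature.NumberTheory.EllipticCurves.LFunctionPrimeCoeffMultiplicative
import Literature.NumberTheory.EllipticCurves.ModularityVersionApProofs
import Literature.NumberTheory.EllipticCurves.HeegnerPointsProofs
import Literature.NumberTheory.EllipticCurves.HeegnerGeomTransversalProofs
import Literature.NumberTheory.EllipticCurves.HeegnerGeomGaloisTransferProofs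
import Literature.NumberTheory.EllipticCurves.Rank1Residual.Predicates
import Literature.NumberTheory.EllipticCurves.BurungaleKobayashiNakamuraOta2026.LocalBottomIndex
import HarnessLib

/-!
# Route UniversalToricDescent — the COHERENT Heegner family of the twin at `3 ∣ N′` EXISTS (kernel theorem):
# the existence + norm-compatibility half of the registered stub `stub_coherentBetaMult` (K1) of line
# `beta-road` on crux `TwinAlgMuZeroAtThree` (stmt-BirchSwinnertonDyer-24737), from tree theorems only

Lead prover `bsd-wall-utd-p1` g28 (`--supports stmt-BirchSwinnertonDyer-24737`).  THEOREMS ONLY (no definition, no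
named fact, no instance, no `sorry`).  BSD is not advanced by this file; no summit statement is proved.

K1 (`stub_coherentBetaMult`, registered VERBATIM since v3 of the skeleton) asks, for a bucket-B twin `E′ = W′`
(multiplicative at `3`) and a degree-one prime `𝔭 ∋ 3` of the Heegner field `K`, for an embedding `jbar : K̄ → ℂ`, a
Heegner family `F` of `3`-power conductors along the anticyclotomic `ℤ₃`-tower `κ` (`HeegnerFamily N′ W′ K κ jbar`), a
sign `α` with `α² = 1` and the TWO-TERM norm relation `Tr_{K_{n+1}/K_n} z_{n+1} = α · z_n`
(`HeegnerFamily.IsNormCompatible F γ α`, Bertolini–Darmon 1996 §2.5 (7)), one of whose layer points is locally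
`3`-indivisible at `𝔭`.  Everything in that list EXCEPT the local indivisibility is a theorem of the tree once three
landed engines are composed, which is what this file does:

* `anticyclotomicTowerSharp` (`AnticyclotomicTowerSharpProofs`, cell `pub/bsd-print-x9`): **`K_k ⊆ K[p^{k+1}]`**
  (`ringClassSubgroup K (p^(k+1)) jbar ≤ κ.layerSubgroup k`) for every imaginary quadratic `K`, odd `p`, EVERY
  anticyclotomic `ℤ_p`-extension `κ` and every `k` — class field theory, PROVED (Perrin-Riou 1987 §3.2, Howard 2004
  §3.3, at every class number);
* `HeegnerGeomLevelDividing.sum_range_pow_smul_z_succ_eq_lFunction_smul_z` with `exists_heegnerFamily_canonical`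
  (`HeegnerGeomLevelDividingRelationProofs`, `HeegnerNormPointExistenceAnyConductorProofs`): the CANONICAL family
  (`z_j = Norm_{K[p^{j+1}]/K_j} y(p^{j+1})`, `y(c) = φ(x(c))` the principal Heegner point of conductor `c` — at
  `p ∣ N` these are the good CM points of conductor `p^{j+1}` of `X₀(N)`, type `(𝒪_{p^{j+1}} → 𝒪_{p^j})` at `p`)
  exists for EVERY datum `Dt`, orientation `β`, embedding `jbar`, and at a prime `p ∣ N` satisfies
  **`∑_{i<p} γ^{p^j i} • z_{j+1} = a_p(W) • z_j`** under the tower binder — the `U_p`-relation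
  `Tr_{K[p^{j+2}]/K[p^{j+1}]} y(p^{j+2}) = a_p · y(p^{j+1})` (Eichler–Shimura `U_p f = a_p f`, Shimura reciprocity on
  `X₀(N)`; Cornut–Vatsal 2007 Lemma 6.14, Bertolini–Darmon 1996 §2.4, Castella 2024 §2.2 before (2.2));
* `a_p(W) = ±1` at a multiplicative prime (`LFunction_apply_prime_of_hasSplitMultiplicativeReductionAtPrime` /
  `…_of_not_split`, Silverman Ex. 8.19(a)).

Results (general odd prime `p ∣ N`, any class number; then the twin at `p = 3`):

* §1 `lFunction_sq_eq_one_of_mult` — `a_p(W)² = 1` at a multiplicative prime.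
* §2 **`exists_isNormCompatible_heegnerFamily_canonical`** — for `K` imaginary quadratic, `p` odd with `p ∣ N`, `κ`
  anticyclotomic with topological generator `γ`, and every `Dt`, `β` (`4N ∣ β² − d_K`), `jbar`: there is
  `F : HeegnerFamily N W K κ jbar` with `F.Dt = Dt`, `F.β = β`, **`F.IsNormCompatible γ (W.LFunction p)`**, and every
  `F.z j` in CANONICAL SHAPE (`F.z j = ∑_{r ∈ R} r • x`, `complexPoint x = y(p^{j+1})`, `x` fixed by `Gal(K̄/K[p^{j+1}])`,
  `R ⊆ Gal(K̄/K_j)` a transversal of `Gal(K̄/K[p^{j+1}])`).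
* §3 `twin_exists_isNormCompatible_heegnerFamily` — the existence + coherence half of K1 on the twin: for `W′`
  multiplicative at `3` of conductor `N′`, `K` Heegner for `N′`, `κ` anticyclotomic, every `jbar` and every datum
  `Dt` there are `F` with `F.Dt = Dt` and `α` with `α² = 1 ∧ F.IsNormCompatible γ α` (`α = a_3(W′)`).
* §4 **`twin_coherentBeta_of_principalIndivisible`** — K1's conclusion (its existence / sign / coherence / local
  indivisibility conjuncts) at a subgroup `D ≤ Γ_K` FROM the elementary research kernel K1″: «for some datum
  `Dt`, orientation `β`, embedding `jbar`, layer `k` and transversal `R ⊆ Gal(K̄/K_k)` of `Gal(K̄/K[3^{k+1}])`, the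
  norm point `∑_{r ∈ R} r • x` of the principal Heegner point `x` of conductor `3^{k+1}` (`complexPoint x = y(3^{k+1})`)
  has a NON-ZERO mod-`3` Kummer class on `Γ_{K_k} ∩ D`».  This is the kernel step of skeleton v16 of line
  beta-road (K1 := theorem of K1″): the coherent family is the canonical one through `(jbar, Dt, β)`, its `z_k`
  IS that norm point (injectivity of `complexPoint`, independence of the transversal sum
  `sum_smul_eq_of_transversal`).

* §5 (appended, g28) `kummerClassOver_ne_zero_of_not_divisible`, **`twin_coherentBeta_of_principalNotDivisible`** — the same
  from the DIVISIBILITY form of K1″ («the norm point is not `3 • P` for any `P` fixed by `Γ_{K_k} ∩ D`», Kummer injectivity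
  `kummerClassOver_eq_zero_iff`) — the registered shape of K1″ in skeleton v16.

HONEST FRAMING: classical CM theory + Eichler–Shimura + class field theory, all already kernel theorems of the tree;
this file only composes them in the binders of crux 24737.  The research content of K1 (local `3`-indivisibility
of a Heegner norm point at a prime above `3`) is untouched and is NOT asserted here.

References: [BertoliniDarmon1996] §2.4–2.5, eq. (7); [Castella2024] arXiv:2409.01360 §2.2 (the points `y_{p^m}`,
`z_m = α^{-m} y_{p^m}`, "norm-compatible"); [Howard2004HeegnerKolyvagin] §3.3; [PerrinRiou1987BSMF] §3.2–3.3;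
[CornutVatsal2007] §6.4 Lemma 6.14; [SilvermanAEC2009] Ex. 8.19(a).
-/

set_option linter.dupNamespace false
set_option autoImplicit false

noncomputable section

open scoped Classical

namespace Summit.BirchSwinnertonDyer.BirchSwinnertonDyer.Theorems.UniversalToricDescentTwinCoherentHeegnerFamily

open NumberField Field WeierstrassCurve Finset
open Literature.NumberTheory.EllipticCurves Literature.NumberTheory.EllipticCurves.ModularForms
open Literature.NumberTheory.EllipticCurves.ZpExtension

/-! ## §1 `a_p = ±1` at a multiplicative prime -/

/-- **`a_p(W)² = 1` at a prime of multiplicative reduction** (`a_p = 1` split, `a_p = −1` non-split).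
[cite: SilvermanAEC2009, Exercise 8.19(a) (p. 230) and §C.16] -/
theorem lFunction_sq_eq_one_of_mult (W : WeierstrassCurve ℚ) [W.IsElliptic] (p : ℕ) [Fact p.Prime]
    (hm : Rank1Residual.Mult W p) : (W.LFunction p) ^ 2 = 1 := by
  by_cases hs : W.HasSplitMultiplicativeReductionAtPrime p
  · rw [W.LFunction_apply_prime_of_hasSplitMultiplicativeReductionAtPrime p hs, one_pow]
  · rw [W.LFunction_apply_prime_of_hasMultiplicativeReductionAtPrime_of_not_split p hm hs]; norm_num

/-- A multiplicative prime divides the conductor. [cite: Silverman1994, IV.10.2(a)] -/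
theorem dvd_conductorNorm_of_mult' (W : WeierstrassCurve ℚ) [W.IsElliptic] (p : ℕ) [Fact p.Prime]
    (hm : Rank1Residual.Mult W p) : p ∣ W.conductorNorm ℤ :=
  (W.dvd_conductorNorm_iff_not_hasGoodReductionAtPrime p).mpr
    (WeierstrassCurve.HasMultiplicativeReduction.not_hasGoodReduction (R := ℤ_[p]) hm)

/-! ## §2 The canonical Heegner family along an anticyclotomic tower at an odd `p ∣ N` is norm-compatible -/

section General

variable {K : Type} [Field K] [NumberField K]

/-- **The canonical Heegner family at an odd prime `p ∣ N` is NORM-COMPATIBLE with sign `a_p(W)`, at every class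
number.**  For `W/ℚ` elliptic with a parametrisation datum `Dt` at level `N`, `K` imaginary quadratic, an orientation
`β` (`4N ∣ β² − d_K`), an embedding `jbar : K̄ → ℂ`, an odd prime `p ∣ N` and an ANTICYCLOTOMIC `ℤ_p`-extension `κ`
with topological generator `γ`: there is a Heegner family `F` along `κ` with `F.Dt = Dt`, `F.β = β`,
`∑_{i<p} γ^{p^j i} • F.z (j+1) = a_p(W) • F.z j` for every `j` (`HeegnerFamily.IsNormCompatible F γ (W.LFunction p)`),
whose norm points are in canonical shape `F.z j = Norm_{K[p^{j+1}]/K_j} x_j`, `complexPoint x_j = y(p^{j+1})`.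
Composition of `exists_heegnerFamily_canonical`, `anticyclotomicTowerSharp` (the tower binder `K_k ⊆ K[p^{k+1}]`,
PROVED) and `HeegnerGeomLevelDividing.sum_range_pow_smul_z_succ_eq_lFunction_smul_z` (the `U_p`-relation).
[cite: BertoliniDarmon1996, §2.4 and §2.5 eq. (7)] [cite: Howard2004HeegnerKolyvagin, §3.3]
[cite: PerrinRiou1987BSMF, §3.2–3.3] [cite: CornutVatsal2007, §6.4 Lemma 6.14] -/
theorem exists_isNormCompatible_heegnerFamily_canonical {N : ℕ} [NeZero N] {W : WeierstrassCurve ℚ} [W.IsElliptic]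
    {p : ℕ} [Fact p.Prime] (hp : Odd p) (hpN : p ∣ N) (hK : IsImaginaryQuadratic K)
    (κ : ZpExtension K p) (hκ : κ.IsAnticyclotomic) {γ : absoluteGaloisGroup K} (hγ : κ.IsTopGenerator γ)
    (Dt : ModularParametrizationData W N) {β : ℤ} (hβ : (4 * N : ℤ) ∣ β ^ 2 - NumberField.discr K)
    (jbar : AlgebraicClosure K →+* ℂ) :
    ∃ F : HeegnerFamily N W K κ jbar, F.Dt = Dt ∧ F.β = β ∧ F.IsNormCompatible γ (W.LFunction p) ∧
      ∀ j : ℕ, ∃ (x : geomPoints (W.baseChange K)) (R : Finset (absoluteGaloisGroup K)),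
        complexPoint W jbar x = heegnerPointComplexOfConductor Dt (NumberField.discr K) β (p ^ (j + 1)) ∧
        (∀ σ ∈ ringClassSubgroup K (p ^ (j + 1)) jbar, σ • x = x) ∧
        (↑R ⊆ (κ.layerSubgroup j : Set (absoluteGaloisGroup K))) ∧
        (∀ τ ∈ κ.layerSubgroup j, ∃! r, r ∈ R ∧ r⁻¹ * τ ∈ ringClassSubgroup K (p ^ (j + 1)) jbar) ∧
        F.z j = ∑ r ∈ R, r • x := by
  have hTw : ∀ k : ℕ, ringClassSubgroup K (p ^ (k + 1)) jbar ≤ κ.layerSubgroup k :=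
    fun k ↦ anticyclotomicTowerSharp K p hp hK κ hκ jbar k
  obtain ⟨F, hFDt, hFβ, -, hcan⟩ := exists_heegnerFamily_canonical hK κ Dt hβ jbar
  refine ⟨F, hFDt, hFβ, ?_, hcan⟩
  intro j
  obtain ⟨x₁, R₁, hx₁, -, hR₁sub, htrans₁, hz₁⟩ := hcan j
  obtain ⟨x₂, R, hx₂, hfix₂, hRsub, htrans, hz⟩ := hcan (j + 1)
  subst hFDt hFβ
  exact HeegnerGeomLevelDividing.sum_range_pow_smul_z_succ_eq_lFunction_smul_z hK hγ hpN F j (hTw j)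
    (hTw (j + 1)) hx₁ hR₁sub htrans₁ hz₁ hx₂ hfix₂ hRsub htrans hz

/-- **The canonical norm point at layer `k` is determined by the principal complex point**: if `F.z k` has the
canonical shape through `(x₀, R₀)` and `x` is ANY geometric point with `complexPoint x = y(p^{k+1})` and `R` ANY
transversal of `Gal(K̄/K[p^{k+1}])` in `Gal(K̄/K_k)`, then `F.z k = ∑_{r ∈ R} r • x` (`complexPoint` is injective;
the transversal sum does not depend on the transversal). [cite: GrossLMS1991, §3 (Tr well defined)] -/
theorem z_eq_sum_of_canonical {N : ℕ} [NeZero N] {W : WeierstrassCurve ℚ} {p : ℕ} [Fact p.Prime]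
    {κ : ZpExtension K p} {jbar : AlgebraicClosure K →+* ℂ} (F : HeegnerFamily N W K κ jbar) (k : ℕ)
    {x₀ : geomPoints (W.baseChange K)} {R₀ : Finset (absoluteGaloisGroup K)}
    (hx₀ : complexPoint W jbar x₀ = heegnerPointComplexOfConductor F.Dt (NumberField.discr K) F.β (p ^ (k + 1)))
    (hfix₀ : ∀ σ ∈ ringClassSubgroup K (p ^ (k + 1)) jbar, σ • x₀ = x₀)
    (hR₀sub : ↑R₀ ⊆ (κ.layerSubgroup k : Set (absoluteGaloisGroup K)))
    (htrans₀ : ∀ τ ∈ κ.layerSubgroup k, ∃! r, r ∈ R₀ ∧ r⁻¹ * τ ∈ ringClassSubgroup K (p ^ (k + 1)) jbar)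
    (hz₀ : F.z k = ∑ r ∈ R₀, r • x₀)
    {x : geomPoints (W.baseChange K)} {R : Finset (absoluteGaloisGroup K)}
    (hx : complexPoint W jbar x = heegnerPointComplexOfConductor F.Dt (NumberField.discr K) F.β (p ^ (k + 1)))
    (hRsub : ↑R ⊆ (κ.layerSubgroup k : Set (absoluteGaloisGroup K)))
    (htrans : ∀ τ ∈ κ.layerSubgroup k, ∃! r, r ∈ R ∧ r⁻¹ * τ ∈ ringClassSubgroup K (p ^ (k + 1)) jbar) :
    F.z k = ∑ r ∈ R, r • x := by
  have hxx : x₀ = x := complexPoint_injective W jbar (hx₀.trans hx.symm)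
  subst hxx
  rw [hz₀]
  exact sum_smul_eq_of_transversal (fun r hr ↦ hR₀sub (Finset.mem_coe.mpr hr))
    (fun r hr ↦ hRsub (Finset.mem_coe.mpr hr)) htrans₀ htrans hfix₀

end General

/-! ## §3 The twin at `p = 3`: existence + coherence half of K1 -/

/-- **The coherent Heegner family of a bucket-B twin EXISTS** (the existence / sign / norm-compatibility conjuncts of
the registered stub `stub_coherentBetaMult`, for EVERY datum `Dt` and EVERY embedding `jbar`): for `W′/ℚ`
multiplicative at `3` of conductor `N′`, `K` imaginary quadratic Heegner for `N′` (so an orientation `β` exists,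
`exists_dvd_sq_sub_discr_holds`), `κ` an anticyclotomic `ℤ₃`-extension with topological generator `γ`: there are a
Heegner family `F` with `F.Dt = Dt` and a sign `α` (`= a_3(W′) = ±1`) with `α² = 1` and `F.IsNormCompatible γ α`.
[cite: BertoliniDarmon1996, §2.5 eq. (7)] [cite: Castella2024, §2.2 (the norm-compatible points z_m)] -/
theorem twin_exists_isNormCompatible_heegnerFamily
    (W' : WeierstrassCurve ℚ) [W'.IsElliptic] (N' : ℕ) [NeZero N'] (K : Type) [Field K] [NumberField K]
    (hm : Rank1Residual.Mult W' 3) (hN : W'.conductorNorm ℤ = N') (hK : IsImaginaryQuadratic K)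
    (hH : SatisfiesHeegnerHypothesis N' K) (κ : ZpExtension K 3) (hκ : κ.IsAnticyclotomic)
    (γ : absoluteGaloisGroup K) [hγ : Fact (κ.IsTopGenerator γ)]
    (jbar : AlgebraicClosure K →+* ℂ) (Dt : ModularParametrizationData W' N') :
    ∃ (F : HeegnerFamily N' W' K κ jbar) (α : ℤ), F.Dt = Dt ∧ α ^ 2 = 1 ∧ F.IsNormCompatible γ α := by
  have h3N : (3 : ℕ) ∣ N' := hN ▸ dvd_conductorNorm_of_mult' W' 3 hm
  obtain ⟨β, hβ⟩ := exists_dvd_sq_sub_discr_holds N' K hK hH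
  obtain ⟨F, hFDt, -, hcoh, -⟩ := exists_isNormCompatible_heegnerFamily_canonical (by decide) h3N hK κ hκ
    hγ.out Dt hβ jbar
  exact ⟨F, W'.LFunction 3, hFDt, lFunction_sq_eq_one_of_mult W' 3 hm, hcoh⟩

/-! ## §4 K1 from the elementary research kernel K1″ (skeleton v16 of line beta-road) -/

/-- **K1 (`stub_coherentBetaMult`'s conclusion) from K1″ («a principal Heegner norm point of `3`-power conductor is
locally `3`-indivisible»).**  Binders of crux 24737, bucket B, at any subgroup `D ≤ Γ_K` (the skeleton takes
`D = D_𝔭`, the decomposition group of a degree-one prime above `3`).  GIVEN a datum `Dt`, an orientation `β`, an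
embedding `jbar`, a layer `k`, a geometric point `x` with `complexPoint x = y(3^{k+1})` (the principal Heegner point of
conductor `3^{k+1}` of `X₀(N′) → E′`, read in `E′(K̄)`), a transversal `R ⊆ Gal(K̄/K_k)` of `Gal(K̄/K[3^{k+1}])`, and the
non-vanishing of the mod-`3` Kummer class of the norm point `∑_{r ∈ R} r • x` on `Γ_{K_k} ∩ D` (hypothesis `hind`),
THEN there are a Heegner family `F` with `F.Dt = Dt` and a sign `α`, `α² = 1`, `F.IsNormCompatible γ α`, one of whose
layer points (`F.z k`) has non-zero mod-`3` Kummer class on `Γ_{K_k} ∩ D`: the canonical coherent family through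
`(jbar, Dt, β)` (§2), whose `z_k` IS `∑_{r ∈ R} r • x` (`z_eq_sum_of_canonical`).
[cite: BertoliniDarmon1996, §2.5 eq. (7)] [cite: Howard2004HeegnerKolyvagin, §3.3] -/
theorem twin_coherentBeta_of_principalIndivisible
    (W' : WeierstrassCurve ℚ) [W'.IsElliptic] (N' : ℕ) [NeZero N'] (K : Type) [Field K] [NumberField K]
    (hm : Rank1Residual.Mult W' 3) (hN : W'.conductorNorm ℤ = N') (hK : IsImaginaryQuadratic K)
    (κ : ZpExtension K 3) (hκ : κ.IsAnticyclotomic)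
    (γ : absoluteGaloisGroup K) [hγ : Fact (κ.IsTopGenerator γ)]
    (D : Subgroup (absoluteGaloisGroup K))
    (jbar : AlgebraicClosure K →+* ℂ) (Dt : ModularParametrizationData W' N') (β : ℤ)
    (hβ : (4 * N' : ℤ) ∣ β ^ 2 - NumberField.discr K) (k : ℕ)
    (x : geomPoints (W'.baseChange K)) (R : Finset (absoluteGaloisGroup K))
    (hx : complexPoint W' jbar x = heegnerPointComplexOfConductor Dt (NumberField.discr K) β (3 ^ (k + 1)))
    (hRsub : ↑R ⊆ (κ.layerSubgroup k : Set (absoluteGaloisGroup K)))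
    (htrans : ∀ τ ∈ κ.layerSubgroup k, ∃! r, r ∈ R ∧ r⁻¹ * τ ∈ ringClassSubgroup K (3 ^ (k + 1)) jbar)
    (hind : ∀ (Q : geomPoints (W'.baseChange K))
      (hQ : ∀ σ ∈ κ.layerSubgroup k ⊓ D, σ • ((3 : ℤ) • Q) = (3 : ℤ) • Q),
      (3 : ℤ) • Q = ∑ r ∈ R, r • x → (W'.baseChange K).kummerClassOver (κ.layerSubgroup k ⊓ D) 3 Q hQ ≠ 0) :
    ∃ (F : HeegnerFamily N' W' K κ jbar) (α : ℤ), F.Dt = Dt ∧ α ^ 2 = 1 ∧ F.IsNormCompatible γ α ∧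
      ∃ k : ℕ, ∀ (Q : geomPoints (W'.baseChange K))
        (hQ : ∀ σ ∈ κ.layerSubgroup k ⊓ D, σ • ((3 : ℤ) • Q) = (3 : ℤ) • Q),
        (3 : ℤ) • Q = F.z k → (W'.baseChange K).kummerClassOver (κ.layerSubgroup k ⊓ D) 3 Q hQ ≠ 0 := by
  have h3N : (3 : ℕ) ∣ N' := hN ▸ dvd_conductorNorm_of_mult' W' 3 hm
  obtain ⟨F, hFDt, hFβ, hcoh, hcan⟩ := exists_isNormCompatible_heegnerFamily_canonical (by decide) h3N hK κ hκ
    hγ.out Dt hβ jbar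
  refine ⟨F, W'.LFunction 3, hFDt, lFunction_sq_eq_one_of_mult W' 3 hm, hcoh, k, fun Q hQ h3Q ↦ ?_⟩
  obtain ⟨x₀, R₀, hx₀, hfix₀, hR₀sub, htrans₀, hz₀⟩ := hcan k
  subst hFDt hFβ
  have hzk : F.z k = ∑ r ∈ R, r • x := z_eq_sum_of_canonical F k hx₀ hfix₀ hR₀sub htrans₀ hz₀ hx hRsub htrans
  exact hind Q hQ (h3Q.trans hzk)

/-! ## §5 K1 from the DIVISIBILITY form of the research kernel (skeleton v16, final shape of K1″)

The Kummer condition of §4 («every third root `Q` of the norm point has non-zero Kummer class on `Γ_{K_k} ∩ D`») is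
EQUIVALENT to the elementary divisibility statement «the norm point is not `3 • P` for any `P ∈ E′(K̄)` fixed by
`Γ_{K_k} ∩ D`» (Kummer injectivity `E(L′)/3 ↪ H¹(L′, E[3])`, the tree's `kummerClassOver_eq_zero_iff`); the registered stub
K1″ of v16 is stated in the divisibility form, and this section is its kernel bridge to K1. -/

/-- **Kummer form from divisibility form**: if `z` is not `3 • P` for any `H`-fixed `P`, then every `Q` with `3 • Q = z`
(and `3 • Q` fixed by `H`) has non-zero Kummer class on `H` (`kummerClassOver_eq_zero_iff`, direction `→`).
[cite: SilvermanAEC2009, VIII.§2 (the Kummer sequence)] -/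
theorem kummerClassOver_ne_zero_of_not_divisible {K : Type} [Field K] (V : WeierstrassCurve K)
    (H : Subgroup (absoluteGaloisGroup K)) {z : geomPoints V}
    (hndiv : ∀ P : geomPoints V, (∀ σ ∈ H, σ • P = P) → (3 : ℤ) • P ≠ z)
    (Q : geomPoints V) (hQ : ∀ σ ∈ H, σ • ((3 : ℤ) • Q) = (3 : ℤ) • Q) (h3Q : (3 : ℤ) • Q = z) :
    V.kummerClassOver H 3 Q hQ ≠ 0 := by
  intro h0
  obtain ⟨P, hPfix, hP⟩ := (kummerClassOver_eq_zero_iff (V := V) (H' := H) 3 Q hQ).mp h0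
  exact hndiv P hPfix (hP.trans h3Q)

/-- **K1 (`stub_coherentBetaMult`'s conclusion) from the DIVISIBILITY form of K1″** — the registered research kernel of
skeleton v16 of line beta-road: GIVEN a datum `Dt`, an orientation `β`, an embedding `jbar`, a layer `k`, the principal
Heegner point `x` of conductor `3^{k+1}` in `E′(K̄)` (`complexPoint x = y(3^{k+1})`), a transversal `R ⊆ Gal(K̄/K_k)` of
`Gal(K̄/K[3^{k+1}])`, and «`∑_{r ∈ R} r • x ≠ 3 • P` for every `P ∈ E′(K̄)` fixed by `Γ_{K_k} ∩ D`» (the norm point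
`Norm_{K[3^{k+1}]/K_k} y(3^{k+1})` is not divisible by `3` over the fixed field of `Γ_{K_k} ∩ D`), THEN there are a coherent
Heegner family `F` with `F.Dt = Dt` (sign `α = a_3(E′)`, `α² = 1`, `F.IsNormCompatible γ α`) and a layer (`k`) at which every
third root of `F.z k` has non-zero Kummer class on `Γ_{K_k} ∩ D`.  (§4 + `kummerClassOver_ne_zero_of_not_divisible`.)
[cite: BertoliniDarmon1996, §2.5 eq. (7)] [cite: Howard2004HeegnerKolyvagin, §3.3] [cite: SilvermanAEC2009, VIII.§2] -/
theorem twin_coherentBeta_of_principalNotDivisible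
    (W' : WeierstrassCurve ℚ) [W'.IsElliptic] (N' : ℕ) [NeZero N'] (K : Type) [Field K] [NumberField K]
    (hm : Rank1Residual.Mult W' 3) (hN : W'.conductorNorm ℤ = N') (hK : IsImaginaryQuadratic K)
    (κ : ZpExtension K 3) (hκ : κ.IsAnticyclotomic)
    (γ : absoluteGaloisGroup K) [hγ : Fact (κ.IsTopGenerator γ)]
    (D : Subgroup (absoluteGaloisGroup K))
    (jbar : AlgebraicClosure K →+* ℂ) (Dt : ModularParametrizationData W' N') (β : ℤ)
    (hβ : (4 * N' : ℤ) ∣ β ^ 2 - NumberField.discr K) (k : ℕ)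
    (x : geomPoints (W'.baseChange K)) (R : Finset (absoluteGaloisGroup K))
    (hx : complexPoint W' jbar x = heegnerPointComplexOfConductor Dt (NumberField.discr K) β (3 ^ (k + 1)))
    (hRsub : ↑R ⊆ (κ.layerSubgroup k : Set (absoluteGaloisGroup K)))
    (htrans : ∀ τ ∈ κ.layerSubgroup k, ∃! r, r ∈ R ∧ r⁻¹ * τ ∈ ringClassSubgroup K (3 ^ (k + 1)) jbar)
    (hndiv : ∀ P : geomPoints (W'.baseChange K), (∀ σ ∈ κ.layerSubgroup k ⊓ D, σ • P = P) →
      (3 : ℤ) • P ≠ ∑ r ∈ R, r • x) :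
    ∃ (F : HeegnerFamily N' W' K κ jbar) (α : ℤ), F.Dt = Dt ∧ α ^ 2 = 1 ∧ F.IsNormCompatible γ α ∧
      ∃ k : ℕ, ∀ (Q : geomPoints (W'.baseChange K))
        (hQ : ∀ σ ∈ κ.layerSubgroup k ⊓ D, σ • ((3 : ℤ) • Q) = (3 : ℤ) • Q),
        (3 : ℤ) • Q = F.z k → (W'.baseChange K).kummerClassOver (κ.layerSubgroup k ⊓ D) 3 Q hQ ≠ 0 :=
  twin_coherentBeta_of_principalIndivisible W' N' K hm hN hK κ hκ γ D jbar Dt β hβ k x R hx hRsub htrans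
    fun Q hQ h3Q ↦ kummerClassOver_ne_zero_of_not_divisible (W'.baseChange K) (κ.layerSubgroup k ⊓ D) hndiv Q hQ h3Q

end Summit.BirchSwinnertonDyer.BirchSwinnertonDyer.Theorems.UniversalToricDescentTwinCoherentHeegnerFamily

end
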